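import Literature.Probability.RandomPlanarGeometry.SAWTurnDensityWindowZ2
import Literature.Probability.RandomPlanarGeometry.HammersleyWelshBound
import Mathlib.Analysis.SpecificLimits.Basic
import HarnessLib

/-!
# Mean turn and tight-U-turn frequencies of uniform SAWs and uniform bridges on `ℤ²`

Topic `Literature/Probability/RandomPlanarGeometry` (continues `SAWTurnDensityWindowZ2.lean`). The
explicit windows (`Zd.turnWindow_Z2`, `Zd.uturnWindow_Z2`) control exceptional COUNTS; this file
draws the consequence for MEANS — the "bulk face" that is reachable without a density limit
(the lane planner's `BridgePatternFreqEnclosure` shape): with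
`meanTurnFreq N = E_N[turns]/(N-1)` (uniform `N`-step SAW), `meanUTurnFreq N = E_N[uturns]/N`,
and the bridge twins `meanTurnFreqB`, `meanUTurnFreqB` (uniform `N`-step bridge),

* all-`N` sandwiches from any edge: `meanTurnFreq_ge/le` (`a(1 - Cθ^N) ≤ E_N[turns]/(N-1) ≤ b + Cθ^N`,
  `N ≥ 2`; uses `c_N ≥ μ^N`), `meanUTurnFreq_ge/le`; for bridges `meanTurnFreqB_ge/le`,
  `meanUTurnFreqB_ge/le` with the extra factor `e^{c√N}` from the Hammersley–Welsh lower bound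
  `b_N ≥ e^{-c√N} μ^N` (`Zd.exp_mul_pow_le_bridgeCount`);
* **eventual enclosures** (kernel `μ ≥ 2.604` + the four memory-18 certificates, computational
  lineage): for every `ε > 0` and all large `N`,
  `12/25 - ε ≤ E_N[turns]/(N-1) ≤ 73/100 + ε` (`meanTurnFreq_window_Z2`), `1/24 - ε ≤ E_N[uturns]/N ≤ 3/16 + ε`
  (`meanUTurnFreq_window_Z2`), and the same for uniform bridges (`meanTurnFreqB_window_Z2`,
  `meanUTurnFreqB_window_Z2`).

Whether the mean frequencies CONVERGE (pattern densities) is not addressed (it is equivalent to the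
differentiability of the pattern pressure at weight one; cf. Madras–Slade §7.2).

## References

* N. Madras, G. Slade, *The Self-Avoiding Walk* (1993), Theorem 7.2.3, §7.1–7.2, Corollary 3.1.6
  [MadrasSlade1993].
* A. Pönitz, P. Tittmann, *Improved upper bounds for self-avoiding walks in ℤᵈ*, Electron. J.
  Combin. 7 (2000) R21, §3 [PonitzTittmann2000].
-/

noncomputable section

open Finset Filter Topology Literature.Probability.LatticeModels
open scoped BigOperators

namespace Literature.Probability.RandomPlanarGeometry.SAW.Zd

/-! ### Mean frequencies (uniform `N`-step SAW; uniform `N`-step bridge) -/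

/-- The mean turn frequency of the uniform `N`-step self-avoiding walk on `ℤ²`
(`E_N[turns]/(N - 1)`; a-idea-2's (o2-B) face). [cite: MadrasSlade1993, §7.1] -/
def meanTurnFreq (N : ℕ) : ℝ :=
  (∑ ω ∈ Zd.saws 2 N, (turns N ω : ℝ)) / (((N : ℝ) - 1) * (Zd.count 2 N : ℝ))

/-- The mean tight-U-turn frequency of the uniform `N`-step self-avoiding walk (`E_N[uturns]/N`).
[cite: MadrasSlade1993, §7.1] -/
def meanUTurnFreq (N : ℕ) : ℝ :=
  (∑ ω ∈ Zd.saws 2 N, (uturns N ω : ℝ)) / ((N : ℝ) * (Zd.count 2 N : ℝ))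

/-- The mean turn frequency of the uniform `N`-step BRIDGE on `ℤ²` (`E^B_N[turns]/(N - 1)`).
[cite: MadrasSlade1993, §7.1] -/
def meanTurnFreqB (N : ℕ) : ℝ :=
  (∑ ω ∈ Zd.bridges 2 N, (turns N ω : ℝ)) / (((N : ℝ) - 1) * (Zd.bridgeCount 2 N : ℝ))

/-- The mean tight-U-turn frequency of the uniform `N`-step bridge (`E^B_N[uturns]/N`).
[cite: MadrasSlade1993, §7.1] -/
def meanUTurnFreqB (N : ℕ) : ℝ :=
  (∑ ω ∈ Zd.bridges 2 N, (uturns N ω : ℝ)) / ((N : ℝ) * (Zd.bridgeCount 2 N : ℝ))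

/-! ### Trivial ranges of the counts -/

/-- `turns N ω ≤ N - 1` (turn events live at `j ≤ N - 2`). [cite: MadrasSlade1993, §7.1] -/
theorem turns_le (N : ℕ) (ω : ℕ → Site 2) : (turns N ω : ℝ) ≤ (N : ℝ) - 1 ∨ N = 0 := by
  classical
  rcases Nat.eq_zero_or_pos N with rfl | hN
  · exact Or.inr rfl
  · left
    have h : turns N ω ≤ N - 1 := by
      rw [turns, Zd.occ]
      calc ((Finset.range (N + 1)).filter (turnAt N ω)).card ≤ (Finset.range (N - 1)).card :=
            Finset.card_le_card fun j hj => by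
              rw [Finset.mem_filter] at hj
              rw [Finset.mem_range]; have := hj.2.1; omega
        _ = N - 1 := Finset.card_range _
    have : ((N - 1 : ℕ) : ℝ) = (N : ℝ) - 1 := by
      rw [Nat.cast_sub hN, Nat.cast_one]
    rw [← this]; exact_mod_cast h

/-- `uturns N ω ≤ N`. [cite: MadrasSlade1993, §7.1] -/
theorem uturns_le (N : ℕ) (ω : ℕ → Site 2) : (uturns N ω : ℝ) ≤ (N : ℝ) := by
  classical
  have h : uturns N ω ≤ N := by
    rw [uturns, Zd.occ]
    calc ((Finset.range (N + 1)).filter (Zd.hairpinAt N ω)).card ≤ (Finset.range N).card :=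
          Finset.card_le_card fun j hj => by
            rw [Finset.mem_filter] at hj
            rw [Finset.mem_range]; have := hj.2.1; omega
      _ = N := Finset.card_range _
  exact_mod_cast h

/-! ### The generic sandwich: a window controls the mean -/

/-- **Lower bound on a mean from a lower edge, any sub-ensemble**: if `#{ω ∈ S : f ω ≤ a·L} ≤ E` with
`a, L ≥ 0`, then `Σ_{ω ∈ S} f ω ≥ a·L·(#S - E)`. [cite: MadrasSlade1993, §1.2] -/
private theorem sum_ge_of_lower_edge {α : Type*} (S : Finset α) (f : α → ℝ) {a L E : ℝ}
    (haL : 0 ≤ a * L) (hE : (((S.filter fun ω => f ω ≤ a * L)).card : ℝ) ≤ E) (hf : ∀ ω ∈ S, 0 ≤ f ω) :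
    a * L * ((S.card : ℝ) - E) ≤ ∑ ω ∈ S, f ω := by
  classical
  set T := S.filter fun ω => ¬ f ω ≤ a * L with hT
  have hsplit : ((S.filter fun ω => f ω ≤ a * L).card : ℝ) + (T.card : ℝ) = S.card := by
    rw [hT]; exact_mod_cast Finset.card_filter_add_card_filter_not _
  have hTcard : (S.card : ℝ) - E ≤ (T.card : ℝ) := by linarith
  calc a * L * ((S.card : ℝ) - E) ≤ a * L * (T.card : ℝ) := mul_le_mul_of_nonneg_left hTcard haL
    _ = ∑ _ω ∈ T, a * L := by rw [Finset.sum_const, nsmul_eq_mul, mul_comm]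
    _ ≤ ∑ ω ∈ T, f ω := Finset.sum_le_sum fun ω hω => by
        rw [hT, Finset.mem_filter] at hω; exact le_of_lt (not_le.1 hω.2)
    _ ≤ ∑ ω ∈ S, f ω := Finset.sum_le_sum_of_subset_of_nonneg (Finset.filter_subset _ _)
        fun ω hω _ => hf ω hω

/-- **Upper bound on a mean from an upper edge, any sub-ensemble**: if `#{ω ∈ S : b·L ≤ f ω} ≤ E`,
`f ≤ M` on `S` with `M ≥ 0` and `b·L ≥ 0`, then `Σ_{ω ∈ S} f ω ≤ b·L·#S + M·E`. [cite: MadrasSlade1993, §1.2] -/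
private theorem sum_le_of_upper_edge {α : Type*} (S : Finset α) (f : α → ℝ) {b L E M : ℝ}
    (hbL : 0 ≤ b * L) (hM : 0 ≤ M) (hE : (((S.filter fun ω => b * L ≤ f ω)).card : ℝ) ≤ E)
    (hf : ∀ ω ∈ S, f ω ≤ M) : ∑ ω ∈ S, f ω ≤ b * L * (S.card : ℝ) + M * E := by
  classical
  set X := S.filter fun ω => b * L ≤ f ω with hX
  set T := S.filter fun ω => ¬ b * L ≤ f ω with hT
  have hsum : ∑ ω ∈ S, f ω = ∑ ω ∈ X, f ω + ∑ ω ∈ T, f ω := by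
    rw [hX, hT]; exact (Finset.sum_filter_add_sum_filter_not S _ f).symm
  have h1 : ∑ ω ∈ X, f ω ≤ M * E :=
    calc ∑ ω ∈ X, f ω ≤ ∑ _ω ∈ X, M := Finset.sum_le_sum fun ω hω => by
            rw [hX, Finset.mem_filter] at hω; exact hf ω hω.1
      _ = M * X.card := by rw [Finset.sum_const, nsmul_eq_mul, mul_comm]
      _ ≤ M * E := mul_le_mul_of_nonneg_left hE hM
  have h2 : ∑ ω ∈ T, f ω ≤ b * L * (S.card : ℝ) :=
    calc ∑ ω ∈ T, f ω ≤ ∑ _ω ∈ T, b * L := Finset.sum_le_sum fun ω hω => by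
            rw [hT, Finset.mem_filter] at hω; exact le_of_lt (not_le.1 hω.2)
      _ = b * L * T.card := by rw [Finset.sum_const, nsmul_eq_mul, mul_comm]
      _ ≤ b * L * (S.card : ℝ) := mul_le_mul_of_nonneg_left
          (by exact_mod_cast Finset.card_le_card (Finset.filter_subset _ S)) hbL
  linarith

/-! ### Walks: the mean turn frequency inside the window, all `N ≥ 2` with explicit error -/

/-- **Mean turn frequency, lower bound**: a lower edge `TurnsLower a θ C` (`a, θ, C ≥ 0`) gives
`meanTurnFreq N ≥ a (1 - C θ^N)` for every `N ≥ 2` (uses `c_N ≥ μ^N`). [cite: MadrasSlade1993, Theorem 7.2.3 (corollary)] -/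
theorem meanTurnFreq_ge {a θ C : ℝ} (h : TurnsLower a θ C) (ha : 0 ≤ a) (hθ : 0 ≤ θ) (hC : 0 ≤ C)
    {N : ℕ} (hN : 2 ≤ N) : a * (1 - C * θ ^ N) ≤ meanTurnFreq N := by
  have hN1 : (0 : ℝ) < (N : ℝ) - 1 := by
    have : (2 : ℝ) ≤ N := by exact_mod_cast hN
    linarith
  have hc : (0 : ℝ) < (Zd.count 2 N : ℝ) := by
    have := Zd.pow_connectiveConstant_le_count 2 N
    exact lt_of_lt_of_le (pow_pos (connectiveConstant_pos 2) N) this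
  have hμc : C * θ ^ N * connectiveConstant 2 ^ N ≤ C * θ ^ N * (Zd.count 2 N : ℝ) :=
    mul_le_mul_of_nonneg_left (Zd.pow_connectiveConstant_le_count 2 N) (mul_nonneg hC (pow_nonneg hθ N))
  have hsum := sum_ge_of_lower_edge (Zd.saws 2 N) (fun ω => (turns N ω : ℝ))
    (mul_nonneg ha hN1.le) ((h N).trans hμc) (fun ω _ => Nat.cast_nonneg _)
  rw [Zd.card_saws] at hsum
  rw [meanTurnFreq, le_div_iff₀ (mul_pos hN1 hc)]
  calc a * (1 - C * θ ^ N) * (((N : ℝ) - 1) * (Zd.count 2 N : ℝ))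
      = a * ((N : ℝ) - 1) * ((Zd.count 2 N : ℝ) - C * θ ^ N * (Zd.count 2 N : ℝ)) := by ring
    _ ≤ ∑ ω ∈ Zd.saws 2 N, (turns N ω : ℝ) := hsum

/-- **Mean turn frequency, upper bound**: an upper edge `TurnsUpper b θ C` (`b, θ, C ≥ 0`) gives
`meanTurnFreq N ≤ b + C θ^N` for every `N ≥ 2`. [cite: MadrasSlade1993, Theorem 7.2.3 (corollary)] -/
theorem meanTurnFreq_le {b θ C : ℝ} (h : TurnsUpper b θ C) (hb : 0 ≤ b) (hθ : 0 ≤ θ) (hC : 0 ≤ C)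
    {N : ℕ} (hN : 2 ≤ N) : meanTurnFreq N ≤ b + C * θ ^ N := by
  have hN1 : (0 : ℝ) < (N : ℝ) - 1 := by
    have : (2 : ℝ) ≤ N := by exact_mod_cast hN
    linarith
  have hc : (0 : ℝ) < (Zd.count 2 N : ℝ) := by
    have := Zd.pow_connectiveConstant_le_count 2 N
    exact lt_of_lt_of_le (pow_pos (connectiveConstant_pos 2) N) this
  have hμc : C * θ ^ N * connectiveConstant 2 ^ N ≤ C * θ ^ N * (Zd.count 2 N : ℝ) :=
    mul_le_mul_of_nonneg_left (Zd.pow_connectiveConstant_le_count 2 N) (mul_nonneg hC (pow_nonneg hθ N))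
  have hsum := sum_le_of_upper_edge (Zd.saws 2 N) (fun ω => (turns N ω : ℝ))
    (mul_nonneg hb hN1.le) hN1.le ((h N).trans hμc)
    (fun ω _ => (turns_le N ω).resolve_right (by omega))
  rw [Zd.card_saws] at hsum
  rw [meanTurnFreq, div_le_iff₀ (mul_pos hN1 hc)]
  calc ∑ ω ∈ Zd.saws 2 N, (turns N ω : ℝ)
      ≤ b * ((N : ℝ) - 1) * (Zd.count 2 N : ℝ) + ((N : ℝ) - 1) * (C * θ ^ N * (Zd.count 2 N : ℝ)) := hsum
    _ = (b + C * θ ^ N) * (((N : ℝ) - 1) * (Zd.count 2 N : ℝ)) := by ring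

/-- **Mean U-turn frequency, lower bound** from `UTurnsLower a θ C`: `meanUTurnFreq N ≥ a (1 - C θ^N)`,
`N ≥ 1`. [cite: MadrasSlade1993, Theorem 7.2.3 (corollary)] -/
theorem meanUTurnFreq_ge {a θ C : ℝ} (h : UTurnsLower a θ C) (ha : 0 ≤ a) (hθ : 0 ≤ θ) (hC : 0 ≤ C)
    {N : ℕ} (hN : 1 ≤ N) : a * (1 - C * θ ^ N) ≤ meanUTurnFreq N := by
  have hN0 : (0 : ℝ) < (N : ℝ) := by exact_mod_cast hN
  have hc : (0 : ℝ) < (Zd.count 2 N : ℝ) := by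
    have := Zd.pow_connectiveConstant_le_count 2 N
    exact lt_of_lt_of_le (pow_pos (connectiveConstant_pos 2) N) this
  have hμc : C * θ ^ N * connectiveConstant 2 ^ N ≤ C * θ ^ N * (Zd.count 2 N : ℝ) :=
    mul_le_mul_of_nonneg_left (Zd.pow_connectiveConstant_le_count 2 N) (mul_nonneg hC (pow_nonneg hθ N))
  have hsum := sum_ge_of_lower_edge (Zd.saws 2 N) (fun ω => (uturns N ω : ℝ))
    (mul_nonneg ha hN0.le) ((h N).trans hμc) (fun ω _ => Nat.cast_nonneg _)
  rw [Zd.card_saws] at hsum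
  rw [meanUTurnFreq, le_div_iff₀ (mul_pos hN0 hc)]
  calc a * (1 - C * θ ^ N) * ((N : ℝ) * (Zd.count 2 N : ℝ))
      = a * (N : ℝ) * ((Zd.count 2 N : ℝ) - C * θ ^ N * (Zd.count 2 N : ℝ)) := by ring
    _ ≤ ∑ ω ∈ Zd.saws 2 N, (uturns N ω : ℝ) := hsum

/-- **Mean U-turn frequency, upper bound** from `UTurnsUpper b θ C`: `meanUTurnFreq N ≤ b + C θ^N`,
`N ≥ 1`. [cite: MadrasSlade1993, Theorem 7.2.3 (corollary)] -/
theorem meanUTurnFreq_le {b θ C : ℝ} (h : UTurnsUpper b θ C) (hb : 0 ≤ b) (hθ : 0 ≤ θ) (hC : 0 ≤ C)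
    {N : ℕ} (hN : 1 ≤ N) : meanUTurnFreq N ≤ b + C * θ ^ N := by
  have hN0 : (0 : ℝ) < (N : ℝ) := by exact_mod_cast hN
  have hc : (0 : ℝ) < (Zd.count 2 N : ℝ) := by
    have := Zd.pow_connectiveConstant_le_count 2 N
    exact lt_of_lt_of_le (pow_pos (connectiveConstant_pos 2) N) this
  have hμc : C * θ ^ N * connectiveConstant 2 ^ N ≤ C * θ ^ N * (Zd.count 2 N : ℝ) :=
    mul_le_mul_of_nonneg_left (Zd.pow_connectiveConstant_le_count 2 N) (mul_nonneg hC (pow_nonneg hθ N))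
  have hsum := sum_le_of_upper_edge (Zd.saws 2 N) (fun ω => (uturns N ω : ℝ))
    (mul_nonneg hb hN0.le) hN0.le ((h N).trans hμc) (fun ω _ => uturns_le N ω)
  rw [Zd.card_saws] at hsum
  rw [meanUTurnFreq, div_le_iff₀ (mul_pos hN0 hc)]
  calc ∑ ω ∈ Zd.saws 2 N, (uturns N ω : ℝ)
      ≤ b * (N : ℝ) * (Zd.count 2 N : ℝ) + (N : ℝ) * (C * θ ^ N * (Zd.count 2 N : ℝ)) := hsum
    _ = (b + C * θ ^ N) * ((N : ℝ) * (Zd.count 2 N : ℝ)) := by ring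

/-! ### Eventual two-sided enclosures of the means (the `BridgePatternFreqEnclosure` shape) -/

/-- `C θ^N → 0` for `0 ≤ θ < 1`, in `ε`–`N₀` form. [cite: MadrasSlade1993, §1.2] -/
private theorem eventually_small {θ C : ℝ} (hθ : 0 ≤ θ) (hθ1 : θ < 1) {ε : ℝ} (hε : 0 < ε) :
    ∃ N₀ : ℕ, ∀ N : ℕ, N₀ ≤ N → C * θ ^ N ≤ ε := by
  have ht : Tendsto (fun N : ℕ => C * θ ^ N) atTop (𝓝 (C * 0)) :=
    (tendsto_pow_atTop_nhds_zero_of_lt_one hθ hθ1).const_mul C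
  rw [mul_zero] at ht
  obtain ⟨N₀, hN₀⟩ := (ht.eventually (eventually_le_nhds hε)).exists_forall_of_atTop
  exact ⟨N₀, hN₀⟩

/-- **Explicit eventual enclosure of the mean turn frequency of uniform SAWs on `ℤ²` (kernel `μ`):**
for every `ε > 0` there is `N₀` with `12/25 - ε ≤ E_N[turns]/(N-1) ≤ 73/100 + ε` for all `N ≥ N₀`.
[cite: MadrasSlade1993, Theorem 7.2.3 (explicit corollary)] -/
theorem meanTurnFreq_window_Z2 {ε : ℝ} (hε : 0 < ε) :
    ∃ N₀ : ℕ, ∀ N : ℕ, N₀ ≤ N → 12 / 25 - ε ≤ meanTurnFreq N ∧ meanTurnFreq N ≤ 73 / 100 + ε := by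
  have hμ : (2.604 : ℝ) ≤ connectiveConstant 2 := by
    rw [Zd.connectiveConstant_two]; exact le_connectiveConstant_2604
  have h₁ := turnsLower_of_le (by norm_num : (0 : ℝ) < 2.604) hμ (12 / 25 : ℝ)
  have h₂ := turnsUpper_of_le (by norm_num : (0 : ℝ) < 2.604) hμ (73 / 100 : ℝ)
  have hθ₁ := theta_lt_one (Λ := 203 / 100) (t := 3 / 5) (μlo := 2.604) (m := 12) (n := 25)
    (by norm_num) (by norm_num) (by norm_num) (by norm_num)
  have hθ₂ := theta_lt_one (Λ := 19949 / 5000) (t := 9 / 5) (μlo := 2.604) (m := 73) (n := 100)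
    (by norm_num) (by norm_num) (by norm_num) (by norm_num)
  have e₁ : (((12 : ℕ) : ℝ) / ((25 : ℕ) : ℝ)) = 12 / 25 := by norm_num
  have e₂ : (((73 : ℕ) : ℝ) / ((100 : ℕ) : ℝ)) = 73 / 100 := by norm_num
  rw [e₁] at hθ₁; rw [e₂] at hθ₂
  set θ₁ : ℝ := 203 / 100 / ((3 / 5 : ℝ) ^ (12 / 25 : ℝ) * 2.604)
  set θ₂ : ℝ := 19949 / 5000 / ((9 / 5 : ℝ) ^ (73 / 100 : ℝ) * 2.604)
  set C₁ : ℝ := 2 ^ 41 * (3 / 5 : ℝ) ^ (12 / 25 : ℝ)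
  set C₂ : ℝ := 2 ^ 41 * (9 / 5 : ℝ) ^ (73 / 100 : ℝ)
  have hθ₁0 : 0 ≤ θ₁ := by positivity
  have hθ₂0 : 0 ≤ θ₂ := by positivity
  have hC₁ : 0 ≤ C₁ := by positivity
  have hC₂ : 0 ≤ C₂ := by positivity
  obtain ⟨N₁, hN₁⟩ := eventually_small (C := 12 / 25 * C₁) hθ₁0 hθ₁ hε
  obtain ⟨N₂, hN₂⟩ := eventually_small (C := C₂) hθ₂0 hθ₂ hε
  refine ⟨max 2 (max N₁ N₂), fun N hN => ⟨?_, ?_⟩⟩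
  · have h := meanTurnFreq_ge h₁ (by norm_num) hθ₁0 hC₁ (le_trans (le_max_left _ _) hN)
    have hs := hN₁ N (le_trans (le_trans (le_max_left _ _) (le_max_right _ _)) hN)
    nlinarith
  · have h := meanTurnFreq_le h₂ (by norm_num) hθ₂0 hC₂ (le_trans (le_max_left _ _) hN)
    have hs := hN₂ N (le_trans (le_trans (le_max_right _ _) (le_max_right _ _)) hN)
    linarith

/-- **Explicit eventual enclosure of the mean tight-U-turn frequency of uniform SAWs on `ℤ²`
(kernel `μ`):** `1/24 - ε ≤ E_N[uturns]/N ≤ 3/16 + ε` for all large `N`.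
[cite: MadrasSlade1993, Theorem 7.2.3 (explicit corollary)] -/
theorem meanUTurnFreq_window_Z2 {ε : ℝ} (hε : 0 < ε) :
    ∃ N₀ : ℕ, ∀ N : ℕ, N₀ ≤ N → 1 / 24 - ε ≤ meanUTurnFreq N ∧ meanUTurnFreq N ≤ 3 / 16 + ε := by
  have hμ : (2.604 : ℝ) ≤ connectiveConstant 2 := by
    rw [Zd.connectiveConstant_two]; exact le_connectiveConstant_2604
  have h₁ := uturnsLower_of_le (by norm_num : (0 : ℝ) < 2.604) hμ (1 / 24 : ℝ)
  have h₂ := uturnsUpper_of_le (by norm_num : (0 : ℝ) < 2.604) hμ (3 / 16 : ℝ)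
  have hθ₁ := theta_lt_one (Λ := 24719 / 10000) (t := 3 / 10) (μlo := 2.604) (m := 1) (n := 24)
    (by norm_num) (by norm_num) (by norm_num) (by norm_num)
  have hθ₂ := theta_lt_one (Λ := 7527 / 2500) (t := 11 / 5) (μlo := 2.604) (m := 3) (n := 16)
    (by norm_num) (by norm_num) (by norm_num) (by norm_num)
  have e₁ : (((1 : ℕ) : ℝ) / ((24 : ℕ) : ℝ)) = 1 / 24 := by norm_num
  have e₂ : (((3 : ℕ) : ℝ) / ((16 : ℕ) : ℝ)) = 3 / 16 := by norm_num
  rw [e₁] at hθ₁; rw [e₂] at hθ₂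
  set θ₁ : ℝ := 24719 / 10000 / ((3 / 10 : ℝ) ^ (1 / 24 : ℝ) * 2.604)
  set θ₂ : ℝ := 7527 / 2500 / ((11 / 5 : ℝ) ^ (3 / 16 : ℝ) * 2.604)
  have hθ₁0 : 0 ≤ θ₁ := by positivity
  have hθ₂0 : 0 ≤ θ₂ := by positivity
  obtain ⟨N₁, hN₁⟩ := eventually_small (C := 1 / 24 * 2 ^ 41) hθ₁0 hθ₁ hε
  obtain ⟨N₂, hN₂⟩ := eventually_small (C := 2 ^ 41) hθ₂0 hθ₂ hε
  refine ⟨max 1 (max N₁ N₂), fun N hN => ⟨?_, ?_⟩⟩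
  · have h := meanUTurnFreq_ge h₁ (by norm_num) hθ₁0 (by positivity) (le_trans (le_max_left _ _) hN)
    have hs := hN₁ N (le_trans (le_trans (le_max_left _ _) (le_max_right _ _)) hN)
    nlinarith
  · have h := meanUTurnFreq_le h₂ (by norm_num) hθ₂0 (by positivity) (le_trans (le_max_left _ _) hN)
    have hs := hN₂ N (le_trans (le_trans (le_max_right _ _) (le_max_right _ _)) hN)
    linarith


/-! ### Bridges: the same enclosures for the uniform bridge law (`b_N ≥ e^{-c√N} μ^N`) -/

/-- `μ^N ≤ e^{c√N} b_N` for some `c ≥ 0` (Hammersley–Welsh lower bound on bridges).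
[cite: MadrasSlade1993, Corollary 3.1.6] -/
private theorem pow_le_exp_mul_bridgeCount :
    ∃ c : ℝ, 0 ≤ c ∧ ∀ N : ℕ, connectiveConstant 2 ^ N ≤ Real.exp (c * Real.sqrt N) * (bridgeCount 2 N : ℝ) := by
  obtain ⟨c, hc⟩ := exp_mul_pow_le_bridgeCount (d := 2)
  refine ⟨max c 0, le_max_right _ _, fun N => ?_⟩
  have h1 : Real.exp (-(max c 0 * Real.sqrt N)) * connectiveConstant 2 ^ N ≤ bridgeCount 2 N :=
    le_trans (mul_le_mul_of_nonneg_right (Real.exp_le_exp.2 (by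
      nlinarith [Real.sqrt_nonneg (N : ℝ), le_max_left c 0])) (pow_nonneg (connectiveConstant_pos 2).le N)) (hc N)
  have hpos : 0 < Real.exp (max c 0 * Real.sqrt N) := Real.exp_pos _
  rw [Real.exp_neg, inv_mul_le_iff₀ hpos] at h1
  exact h1

/-- `θ^N e^{c√N} → 0` for `0 < θ < 1`, in `ε`–`N₀` form (for `√N ≥ 2c/(-log θ)` the square root is
dominated: `θ^N e^{c√N} ≤ e^{(log θ/2) N}`). [cite: MadrasSlade1993, §1.2] -/
private theorem eventually_small_sqrt {θ : ℝ} (hθ : 0 < θ) (hθ1 : θ < 1) {c : ℝ} (hc : 0 ≤ c) (C : ℝ)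
    (hC : 0 ≤ C) {ε : ℝ} (hε : 0 < ε) :
    ∃ N₀ : ℕ, ∀ N : ℕ, N₀ ≤ N → C * (θ ^ N * Real.exp (c * Real.sqrt N)) ≤ ε := by
  set L : ℝ := -Real.log θ with hL
  have hL0 : 0 < L := by rw [hL, neg_pos]; exact Real.log_neg hθ hθ1
  set r : ℝ := Real.exp (-(L / 2)) with hr
  have hr0 : 0 ≤ r := (Real.exp_pos _).le
  have hr1 : r < 1 := by rw [hr, Real.exp_lt_one_iff]; linarith
  obtain ⟨N₁, hN₁⟩ := eventually_small (C := C) hr0 hr1 hε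
  set K : ℝ := 2 * c / L with hK
  have hK0 : 0 ≤ K := by positivity
  refine ⟨max N₁ ⌈K ^ 2⌉₊, fun N hN => ?_⟩
  have hNK : K ^ 2 ≤ (N : ℝ) := le_trans (Nat.le_ceil _) (by exact_mod_cast le_trans (le_max_right _ _) hN)
  have hsqrt : K ≤ Real.sqrt N := by
    rw [show K = Real.sqrt (K ^ 2) by rw [Real.sqrt_sq hK0]]
    exact Real.sqrt_le_sqrt hNK
  -- `c √N ≤ (L/2) N`
  have hcs : c * Real.sqrt N ≤ L / 2 * N := by
    have h1 : c ≤ L / 2 * Real.sqrt N := by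
      have : L / 2 * K = c := by rw [hK]; field_simp
      nlinarith [hL0]
    have h2 := mul_le_mul_of_nonneg_right h1 (Real.sqrt_nonneg (N : ℝ))
    rw [mul_assoc, Real.mul_self_sqrt (Nat.cast_nonneg N)] at h2
    exact h2
  -- `θ^N e^{c√N} ≤ r^N`
  have hθN : θ ^ N = Real.exp (-(L * N)) := by
    rw [hL, neg_mul, neg_neg, mul_comm, ← Real.log_pow, Real.exp_log (pow_pos hθ N)]
  have hle : θ ^ N * Real.exp (c * Real.sqrt N) ≤ r ^ N := by
    rw [hθN, ← Real.exp_add, hr, ← Real.exp_nat_mul]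
    exact Real.exp_le_exp.2 (by nlinarith)
  exact le_trans (mul_le_mul_of_nonneg_left hle hC) (hN₁ N (le_trans (le_max_left _ _) hN))

/-- **Mean turn frequency of uniform BRIDGES, lower bound** from a lower edge for walks:
`meanTurnFreqB N ≥ a (1 - C θ^N e^{c√N})`, `N ≥ 2`, with the Hammersley–Welsh `c`.
[cite: MadrasSlade1993, Theorem 7.2.3 (corollary); Corollary 3.1.6] -/
theorem meanTurnFreqB_ge {a θ C : ℝ} (h : TurnsLower a θ C) (ha : 0 ≤ a) (hθ : 0 ≤ θ) (hC : 0 ≤ C) :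
    ∃ c : ℝ, 0 ≤ c ∧ ∀ N : ℕ, 2 ≤ N →
      a * (1 - C * (θ ^ N * Real.exp (c * Real.sqrt N))) ≤ meanTurnFreqB N := by
  obtain ⟨c, hc0, hc⟩ := pow_le_exp_mul_bridgeCount
  refine ⟨c, hc0, fun N hN => ?_⟩
  have hN1 : (0 : ℝ) < (N : ℝ) - 1 := by
    have : (2 : ℝ) ≤ N := by exact_mod_cast hN
    linarith
  have hb : (0 : ℝ) < (bridgeCount 2 N : ℝ) := by exact_mod_cast Zd.one_le_bridgeCount (d := 2) N
  have hμb : C * θ ^ N * connectiveConstant 2 ^ N ≤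
      C * (θ ^ N * Real.exp (c * Real.sqrt N)) * (bridgeCount 2 N : ℝ) := by
    calc C * θ ^ N * connectiveConstant 2 ^ N
        ≤ C * θ ^ N * (Real.exp (c * Real.sqrt N) * (bridgeCount 2 N : ℝ)) :=
          mul_le_mul_of_nonneg_left (hc N) (mul_nonneg hC (pow_nonneg hθ N))
      _ = _ := by ring
  have hsum := sum_ge_of_lower_edge (Zd.bridges 2 N) (fun ω => (turns N ω : ℝ))
    (mul_nonneg ha hN1.le) ((h.card_filter_le (fun ω hω => (Zd.mem_bridges.1 hω).1)).trans hμb)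
    (fun ω _ => Nat.cast_nonneg _)
  rw [meanTurnFreqB, le_div_iff₀ (mul_pos hN1 hb)]
  have hcardB : ((Zd.bridges 2 N).card : ℝ) = (bridgeCount 2 N : ℝ) := by rw [bridgeCount]
  rw [hcardB] at hsum
  calc a * (1 - C * (θ ^ N * Real.exp (c * Real.sqrt N))) * (((N : ℝ) - 1) * (bridgeCount 2 N : ℝ))
      = a * ((N : ℝ) - 1) * ((bridgeCount 2 N : ℝ) -
          C * (θ ^ N * Real.exp (c * Real.sqrt N)) * (bridgeCount 2 N : ℝ)) := by ring
    _ ≤ ∑ ω ∈ Zd.bridges 2 N, (turns N ω : ℝ) := hsum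

/-- **Mean turn frequency of uniform BRIDGES, upper bound** from an upper edge for walks:
`meanTurnFreqB N ≤ b + C θ^N e^{c√N}`, `N ≥ 2`. [cite: MadrasSlade1993, Theorem 7.2.3 (corollary); Corollary 3.1.6] -/
theorem meanTurnFreqB_le {b θ C : ℝ} (h : TurnsUpper b θ C) (hb : 0 ≤ b) (hθ : 0 ≤ θ) (hC : 0 ≤ C) :
    ∃ c : ℝ, 0 ≤ c ∧ ∀ N : ℕ, 2 ≤ N →
      meanTurnFreqB N ≤ b + C * (θ ^ N * Real.exp (c * Real.sqrt N)) := by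
  obtain ⟨c, hc0, hc⟩ := pow_le_exp_mul_bridgeCount
  refine ⟨c, hc0, fun N hN => ?_⟩
  have hN1 : (0 : ℝ) < (N : ℝ) - 1 := by
    have : (2 : ℝ) ≤ N := by exact_mod_cast hN
    linarith
  have hbpos : (0 : ℝ) < (bridgeCount 2 N : ℝ) := by exact_mod_cast Zd.one_le_bridgeCount (d := 2) N
  have hμb : C * θ ^ N * connectiveConstant 2 ^ N ≤
      C * (θ ^ N * Real.exp (c * Real.sqrt N)) * (bridgeCount 2 N : ℝ) := by
    calc C * θ ^ N * connectiveConstant 2 ^ N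
        ≤ C * θ ^ N * (Real.exp (c * Real.sqrt N) * (bridgeCount 2 N : ℝ)) :=
          mul_le_mul_of_nonneg_left (hc N) (mul_nonneg hC (pow_nonneg hθ N))
      _ = _ := by ring
  have hsum := sum_le_of_upper_edge (Zd.bridges 2 N) (fun ω => (turns N ω : ℝ))
    (mul_nonneg hb hN1.le) hN1.le ((h.card_filter_le (fun ω hω => (Zd.mem_bridges.1 hω).1)).trans hμb)
    (fun ω _ => (turns_le N ω).resolve_right (by omega))
  rw [meanTurnFreqB, div_le_iff₀ (mul_pos hN1 hbpos)]
  have hcardB : ((Zd.bridges 2 N).card : ℝ) = (bridgeCount 2 N : ℝ) := by rw [bridgeCount]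
  rw [hcardB] at hsum
  calc ∑ ω ∈ Zd.bridges 2 N, (turns N ω : ℝ)
      ≤ b * ((N : ℝ) - 1) * (bridgeCount 2 N : ℝ) +
          ((N : ℝ) - 1) * (C * (θ ^ N * Real.exp (c * Real.sqrt N)) * (bridgeCount 2 N : ℝ)) := hsum
    _ = (b + C * (θ ^ N * Real.exp (c * Real.sqrt N))) * (((N : ℝ) - 1) * (bridgeCount 2 N : ℝ)) := by ring

/-- **Explicit eventual enclosure of the mean turn frequency of uniform BRIDGES on `ℤ²` (kernel `μ`):**
for every `ε > 0`, `12/25 - ε ≤ E^B_N[turns]/(N-1) ≤ 73/100 + ε` for all large `N`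
(a-idea-2's `BridgePatternFreqEnclosure` shape for the turn event).
[cite: MadrasSlade1993, Theorem 7.2.3 (explicit corollary)] -/
theorem meanTurnFreqB_window_Z2 {ε : ℝ} (hε : 0 < ε) :
    ∃ N₀ : ℕ, ∀ N : ℕ, N₀ ≤ N → 12 / 25 - ε ≤ meanTurnFreqB N ∧ meanTurnFreqB N ≤ 73 / 100 + ε := by
  have hμ : (2.604 : ℝ) ≤ connectiveConstant 2 := by
    rw [Zd.connectiveConstant_two]; exact le_connectiveConstant_2604
  have h₁ := turnsLower_of_le (by norm_num : (0 : ℝ) < 2.604) hμ (12 / 25 : ℝ)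
  have h₂ := turnsUpper_of_le (by norm_num : (0 : ℝ) < 2.604) hμ (73 / 100 : ℝ)
  have hθ₁ := theta_lt_one (Λ := 203 / 100) (t := 3 / 5) (μlo := 2.604) (m := 12) (n := 25)
    (by norm_num) (by norm_num) (by norm_num) (by norm_num)
  have hθ₂ := theta_lt_one (Λ := 19949 / 5000) (t := 9 / 5) (μlo := 2.604) (m := 73) (n := 100)
    (by norm_num) (by norm_num) (by norm_num) (by norm_num)
  have e₁ : (((12 : ℕ) : ℝ) / ((25 : ℕ) : ℝ)) = 12 / 25 := by norm_num
  have e₂ : (((73 : ℕ) : ℝ) / ((100 : ℕ) : ℝ)) = 73 / 100 := by norm_num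
  rw [e₁] at hθ₁; rw [e₂] at hθ₂
  set θ₁ : ℝ := 203 / 100 / ((3 / 5 : ℝ) ^ (12 / 25 : ℝ) * 2.604)
  set θ₂ : ℝ := 19949 / 5000 / ((9 / 5 : ℝ) ^ (73 / 100 : ℝ) * 2.604)
  set C₁ : ℝ := 2 ^ 41 * (3 / 5 : ℝ) ^ (12 / 25 : ℝ)
  set C₂ : ℝ := 2 ^ 41 * (9 / 5 : ℝ) ^ (73 / 100 : ℝ)
  have hθ₁0 : 0 < θ₁ := by positivity
  have hθ₂0 : 0 < θ₂ := by positivity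
  have hC₁ : 0 ≤ C₁ := by positivity
  have hC₂ : 0 ≤ C₂ := by positivity
  obtain ⟨c₁, hc₁, hlo⟩ := meanTurnFreqB_ge h₁ (by norm_num) hθ₁0.le hC₁
  obtain ⟨c₂, hc₂, hup⟩ := meanTurnFreqB_le h₂ (by norm_num) hθ₂0.le hC₂
  obtain ⟨N₁, hN₁⟩ := eventually_small_sqrt hθ₁0 hθ₁ hc₁ (12 / 25 * C₁) (by positivity) hε
  obtain ⟨N₂, hN₂⟩ := eventually_small_sqrt hθ₂0 hθ₂ hc₂ C₂ hC₂ hε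
  refine ⟨max 2 (max N₁ N₂), fun N hN => ⟨?_, ?_⟩⟩
  · have h := hlo N (le_trans (le_max_left _ _) hN)
    have hs := hN₁ N (le_trans (le_trans (le_max_left _ _) (le_max_right _ _)) hN)
    nlinarith
  · have h := hup N (le_trans (le_max_left _ _) hN)
    have hs := hN₂ N (le_trans (le_trans (le_max_right _ _) (le_max_right _ _)) hN)
    linarith


/-- **Mean U-turn frequency of uniform BRIDGES, lower bound**: `meanUTurnFreqB N ≥ a (1 - C θ^N e^{c√N})`,
`N ≥ 1`. [cite: MadrasSlade1993, Theorem 7.2.3 (corollary); Corollary 3.1.6] -/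
theorem meanUTurnFreqB_ge {a θ C : ℝ} (h : UTurnsLower a θ C) (ha : 0 ≤ a) (hθ : 0 ≤ θ) (hC : 0 ≤ C) :
    ∃ c : ℝ, 0 ≤ c ∧ ∀ N : ℕ, 1 ≤ N →
      a * (1 - C * (θ ^ N * Real.exp (c * Real.sqrt N))) ≤ meanUTurnFreqB N := by
  obtain ⟨c, hc0, hc⟩ := pow_le_exp_mul_bridgeCount
  refine ⟨c, hc0, fun N hN => ?_⟩
  have hN0 : (0 : ℝ) < (N : ℝ) := by exact_mod_cast hN
  have hb : (0 : ℝ) < (bridgeCount 2 N : ℝ) := by exact_mod_cast Zd.one_le_bridgeCount (d := 2) N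
  have hμb : C * θ ^ N * connectiveConstant 2 ^ N ≤
      C * (θ ^ N * Real.exp (c * Real.sqrt N)) * (bridgeCount 2 N : ℝ) := by
    calc C * θ ^ N * connectiveConstant 2 ^ N
        ≤ C * θ ^ N * (Real.exp (c * Real.sqrt N) * (bridgeCount 2 N : ℝ)) :=
          mul_le_mul_of_nonneg_left (hc N) (mul_nonneg hC (pow_nonneg hθ N))
      _ = _ := by ring
  have hsum := sum_ge_of_lower_edge (Zd.bridges 2 N) (fun ω => (uturns N ω : ℝ))
    (mul_nonneg ha hN0.le) ((h.card_filter_le (fun ω hω => (Zd.mem_bridges.1 hω).1)).trans hμb)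
    (fun ω _ => Nat.cast_nonneg _)
  rw [meanUTurnFreqB, le_div_iff₀ (mul_pos hN0 hb)]
  have hcardB : ((Zd.bridges 2 N).card : ℝ) = (bridgeCount 2 N : ℝ) := by rw [bridgeCount]
  rw [hcardB] at hsum
  calc a * (1 - C * (θ ^ N * Real.exp (c * Real.sqrt N))) * ((N : ℝ) * (bridgeCount 2 N : ℝ))
      = a * (N : ℝ) * ((bridgeCount 2 N : ℝ) -
          C * (θ ^ N * Real.exp (c * Real.sqrt N)) * (bridgeCount 2 N : ℝ)) := by ring
    _ ≤ ∑ ω ∈ Zd.bridges 2 N, (uturns N ω : ℝ) := hsum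

/-- **Mean U-turn frequency of uniform BRIDGES, upper bound**: `meanUTurnFreqB N ≤ b + C θ^N e^{c√N}`,
`N ≥ 1`. [cite: MadrasSlade1993, Theorem 7.2.3 (corollary); Corollary 3.1.6] -/
theorem meanUTurnFreqB_le {b θ C : ℝ} (h : UTurnsUpper b θ C) (hb : 0 ≤ b) (hθ : 0 ≤ θ) (hC : 0 ≤ C) :
    ∃ c : ℝ, 0 ≤ c ∧ ∀ N : ℕ, 1 ≤ N →
      meanUTurnFreqB N ≤ b + C * (θ ^ N * Real.exp (c * Real.sqrt N)) := by
  obtain ⟨c, hc0, hc⟩ := pow_le_exp_mul_bridgeCount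
  refine ⟨c, hc0, fun N hN => ?_⟩
  have hN0 : (0 : ℝ) < (N : ℝ) := by exact_mod_cast hN
  have hbpos : (0 : ℝ) < (bridgeCount 2 N : ℝ) := by exact_mod_cast Zd.one_le_bridgeCount (d := 2) N
  have hμb : C * θ ^ N * connectiveConstant 2 ^ N ≤
      C * (θ ^ N * Real.exp (c * Real.sqrt N)) * (bridgeCount 2 N : ℝ) := by
    calc C * θ ^ N * connectiveConstant 2 ^ N
        ≤ C * θ ^ N * (Real.exp (c * Real.sqrt N) * (bridgeCount 2 N : ℝ)) :=
          mul_le_mul_of_nonneg_left (hc N) (mul_nonneg hC (pow_nonneg hθ N))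
      _ = _ := by ring
  have hsum := sum_le_of_upper_edge (Zd.bridges 2 N) (fun ω => (uturns N ω : ℝ))
    (mul_nonneg hb hN0.le) hN0.le ((h.card_filter_le (fun ω hω => (Zd.mem_bridges.1 hω).1)).trans hμb)
    (fun ω _ => uturns_le N ω)
  rw [meanUTurnFreqB, div_le_iff₀ (mul_pos hN0 hbpos)]
  have hcardB : ((Zd.bridges 2 N).card : ℝ) = (bridgeCount 2 N : ℝ) := by rw [bridgeCount]
  rw [hcardB] at hsum
  calc ∑ ω ∈ Zd.bridges 2 N, (uturns N ω : ℝ)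
      ≤ b * (N : ℝ) * (bridgeCount 2 N : ℝ) +
          (N : ℝ) * (C * (θ ^ N * Real.exp (c * Real.sqrt N)) * (bridgeCount 2 N : ℝ)) := hsum
    _ = (b + C * (θ ^ N * Real.exp (c * Real.sqrt N))) * ((N : ℝ) * (bridgeCount 2 N : ℝ)) := by ring

/-- **Explicit eventual enclosure of the mean tight-U-turn frequency of uniform BRIDGES on `ℤ²`
(kernel `μ`):** `1/24 - ε ≤ E^B_N[uturns]/N ≤ 3/16 + ε` for all large `N` — a-idea-2's
`BridgePatternFreqEnclosure hairpinAt (1/24 - ε) (3/16 + ε) N₀`. [cite: MadrasSlade1993, Theorem 7.2.3 (explicit corollary)] -/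
theorem meanUTurnFreqB_window_Z2 {ε : ℝ} (hε : 0 < ε) :
    ∃ N₀ : ℕ, ∀ N : ℕ, N₀ ≤ N → 1 / 24 - ε ≤ meanUTurnFreqB N ∧ meanUTurnFreqB N ≤ 3 / 16 + ε := by
  have hμ : (2.604 : ℝ) ≤ connectiveConstant 2 := by
    rw [Zd.connectiveConstant_two]; exact le_connectiveConstant_2604
  have h₁ := uturnsLower_of_le (by norm_num : (0 : ℝ) < 2.604) hμ (1 / 24 : ℝ)
  have h₂ := uturnsUpper_of_le (by norm_num : (0 : ℝ) < 2.604) hμ (3 / 16 : ℝ)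
  have hθ₁ := theta_lt_one (Λ := 24719 / 10000) (t := 3 / 10) (μlo := 2.604) (m := 1) (n := 24)
    (by norm_num) (by norm_num) (by norm_num) (by norm_num)
  have hθ₂ := theta_lt_one (Λ := 7527 / 2500) (t := 11 / 5) (μlo := 2.604) (m := 3) (n := 16)
    (by norm_num) (by norm_num) (by norm_num) (by norm_num)
  have e₁ : (((1 : ℕ) : ℝ) / ((24 : ℕ) : ℝ)) = 1 / 24 := by norm_num
  have e₂ : (((3 : ℕ) : ℝ) / ((16 : ℕ) : ℝ)) = 3 / 16 := by norm_num
  rw [e₁] at hθ₁; rw [e₂] at hθ₂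
  set θ₁ : ℝ := 24719 / 10000 / ((3 / 10 : ℝ) ^ (1 / 24 : ℝ) * 2.604)
  set θ₂ : ℝ := 7527 / 2500 / ((11 / 5 : ℝ) ^ (3 / 16 : ℝ) * 2.604)
  have hθ₁0 : 0 < θ₁ := by positivity
  have hθ₂0 : 0 < θ₂ := by positivity
  obtain ⟨c₁, hc₁, hlo⟩ := meanUTurnFreqB_ge h₁ (by norm_num) hθ₁0.le (by positivity)
  obtain ⟨c₂, hc₂, hup⟩ := meanUTurnFreqB_le h₂ (by norm_num) hθ₂0.le (by positivity)
  obtain ⟨N₁, hN₁⟩ := eventually_small_sqrt hθ₁0 hθ₁ hc₁ (1 / 24 * 2 ^ 41) (by positivity) hε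
  obtain ⟨N₂, hN₂⟩ := eventually_small_sqrt hθ₂0 hθ₂ hc₂ (2 ^ 41) (by positivity) hε
  refine ⟨max 1 (max N₁ N₂), fun N hN => ⟨?_, ?_⟩⟩
  · have h := hlo N (le_trans (le_max_left _ _) hN)
    have hs := hN₁ N (le_trans (le_trans (le_max_left _ _) (le_max_right _ _)) hN)
    nlinarith
  · have h := hup N (le_trans (le_max_left _ _) hN)
    have hs := hN₂ N (le_trans (le_trans (le_max_right _ _) (le_max_right _ _)) hN)
    linarith

end Literature.Probability.RandomPlanarGeometry.SAW.Zd
end
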